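import Summits.QuantumFields.BalabanUV.Beta.RemainderExplicitHistoryDiagonalRatePowerTailAll

/-!
# RemainderExplicitHistoryDiagonalRatePowerProfileAll — ROAD P3, ORDER-0 PROFILE FAMILY: THE POWER PROFILES `ρ(a) = M₀∕(a+1)^{1+q}` FOR EVERY
# `q > 1` — second and higher moments included — REACH THEIR CONTINUUM COUPLING AT THE TWO-SIDED, POINTWISE RATE `√m∕n^q`: tails from
# above `≤ M₀(1 + 2^q∕q)∕(k+1)^q` (every `q ≥ 1`) and from below `≥ (M₀∕(2·2^q))∕(k+1)^q` (every `q ≥ 0`), total mass `≤ M₀(1 + 1∕q)`; END: such a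
# pinned family exists for every `g_IR ∈ ]0,γ]` once `2M₀(1+1∕q)γ ≤ b`.  CENSUS for road P3's polynomial profiles `a^{−p}` after this file:
# `p ≤ 3∕2` NOT m-uniform (generation 48); EVERY `p > 3∕2`: continuum coupling reached at the two-sided pointwise rate `√m∕n^{p−1}`
# (generations 49–50 for `p < 3`, this station for `p ≥ 3` — and for all `p > 2` without `m ≤ n + 1` on the upper side)
# (fourth file of station S-d4p3-g51-1 «the tails alone buy the rate»; the fifth treats the cutoffs beyond the half for the classes of generations 49–50 and the lower side)

Cell `pub-balaban`, β-function sub-cell, BINDER row D4 «RemainderConst leaves for Bałaban's split» (`HOME/BINDER-OWNERS.md`; owner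
lineage `b2b-balaban-beta-an4`; this file by co-owner #3 lineage `b2b-balaban-beta-d4-p3`, road P3 «the reduction road», generation 51,
station S-d4p3-g51-1, fourth file; imports the station's third file `RemainderExplicitHistoryDiagonalRatePowerTailAll`), β-FLOW
TEAM duty (1); FREEZE (0) honoured (def-free module in road P3's own `RemainderExplicit*` series; no leaf, no interface, no Literature file).
SOURCE OF THE SHAPES ONLY: [Balaban1987RG1] (0.20) p. 256, (0.31) and Thm 2 p. 259, §5 p. 298.  Pure real analysis about ONE explicit toy
family (ours, not Bałaban's).

HONEST FRAMING (page 1 of everything the β sub-cell writes).  *"Discharging BetaPertH makes Bałaban's UV stability UNCONDITIONAL — a real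
constructive-QFT result; it is NOT the continuum limit and NOT the Clay problem."*  THIS FILE DISCHARGES NOTHING OF THE KIND.  Generation
49's eighth file priced the power profile's tails for `0 < q ≤ 1`, generation 50's fourth file for `1 ≤ q ≤ 2` (writing `2^q ≤ 4`); here the
same two telescoping ∕ block arguments are run with the factor `2^q` kept, so the tails are two-sided powers for EVERY `q ≥ 1` (§1), and the
third file's rate for every summable power tail applies (§2): road P3's polynomial profiles `a^{−p}` with a finite SECOND (or any higher)
moment, `p ≥ 3` — generation 50's census OPEN (ii′) «(T1) fails; a two-variable majorant is needed» — reach their continuum coupling at the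
same two-sided pointwise rate `√m∕n^{p−1}` as the first-moment ones, by the SAME one-variable majorant run over the whole run (second file).
Nothing of Bałaban's (1.22) is asserted or constructed; row D4 class UNCHANGED (critical-path width 0; instance 0∕1; D4 DISCHARGE NO DATE);
NOT B12 Thm 2, NOT BetaPertH, NOT continuum, NOT Clay.  HONEST DEPENDENCY: continuum YM on T⁴ ⇐ BetaPertH ∧ nine spine estimates (0/9
proved); BetaPertH ⇐ (D1) ∧ (D4) ∧ CAP+tail; G-an2-4 gates asym, D1 and NE2/3/4.  ABSOLUTE RULE: nothing is cited as a fact.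

WHAT IS PROVED ([folklore]; 0 sorry; 0 `def`).
* §1 `powerProfileAll_sum_le` (`q ≥ 1`: `Σ_{a<N} ρ_a ≤ M₀(1 + 1∕q)`), **`powerProfileAll_tail_le`** (`q ≥ 1`: tails `≤ M₀(1 + 2^q∕q)∕(k+1)^q`),
  **`powerProfileAll_tail_ge`** (`q ≥ 0`, `k ≥ 1`, `N ≥ 2k`: tails `≥ (M₀∕(2·2^q))∕(k+1)^q`).
* §2 **`powerProfileAll_rate`** (`2Wγ < b`, upper, every `q > 1`, ALL `n`), **`powerProfileAll_rate_tail`** (`Wγ < b`, upper, ALL `n`),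
  **`powerProfileAll_rate_lower_pointwise`** (`Wγ < b`, lower AT `m`, `1 ≤ m ≤ n+1`), END **`exists_family_powerProfileAll_rate`** (`2M₀(1+1∕q)γ ≤ b`:
  a pinned family with BOTH sides at every `m` above the thresholds).
All letters NOT-IN-PRINT; `BetaFlowAsPrinted S` records a Markov β_n only ⇒ no junction of the as-printed interface changes.
-/

noncomputable section

open Finset Filter Topology

namespace Summit.QuantumFields.BalabanUV.Beta.RemainderExplicitHistoryDiagonalRatePowerProfileAll

open Literature.MathematicalPhysics.QuantumFieldTheory.Balaban1983to89
open Literature.MathematicalPhysics.QuantumFieldTheory.Balaban1983to89.FlowStep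
open Literature.MathematicalPhysics.QuantumFieldTheory.Balaban1983to89.T4CouplingMatching
open Literature.MathematicalPhysics.QuantumFieldTheory.Balaban1983to89.T4ContinuumCoupling
open Summit.QuantumFields.BalabanUV.Beta.RemainderExplicitHistoryDiagonalRateUniform (powerTail_rate_lower_pointwise)
open Summit.QuantumFields.BalabanUV.Beta.RemainderExplicitHistoryDiagonalRatePowerProfileTwo (sum_Ico_tail_le)
open Summit.QuantumFields.BalabanUV.Beta.RemainderExplicitHistoryDiagonalRatePowerTailAll

variable {β : HBeta} {b γ W : ℝ} {ρ : ℕ → ℝ}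

/-! ## §1 The tails of the power profile for every exponent `q ≥ 1` -/

/-- TOTAL MASS OF THE POWER PROFILE, `q ≥ 1`: `Σ_{a<N} ρ_a ≤ M₀(1 + 1∕q)` (the term `a = 0` is `M₀`, the rest is the telescoped `(1+q)`-tail from
`k = 1`, `…RatePowerProfileTwo.sum_Ico_tail_le`). [folklore] -/
theorem powerProfileAll_sum_le {M₀ q : ℝ} (hM₀ : 0 ≤ M₀) (hq1 : 1 ≤ q)
    (hρ : ∀ a, ρ a = M₀ / ((((a : ℝ) + 1) ^ q) * ((a : ℝ) + 1))) (N : ℕ) :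
    ∑ a ∈ range N, ρ a ≤ M₀ * (1 + 1 / q) := by
  have hq0 : 0 < q := by linarith
  have hρ0 : ∀ a, 0 ≤ ρ a := fun a => by rw [hρ a]; positivity
  rcases Nat.eq_zero_or_pos N with hN | hN
  · subst hN; rw [Finset.sum_range_zero]; positivity
  rw [Finset.range_eq_Ico, Finset.sum_eq_sum_Ico_succ_bot hN]
  have h0 : ρ 0 = M₀ := by rw [hρ 0]; simp
  have hscale : ∑ a ∈ Ico 1 N, ρ a = M₀ * ∑ a ∈ Ico 1 N, 1 / ((((a : ℝ) + 1) ^ q) * ((a : ℝ) + 1)) := by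
    rw [Finset.mul_sum]; exact sum_congr rfl fun a _ => by rw [hρ a]; ring
  have h1 := sum_Ico_tail_le hq1 (k := 1) le_rfl (Nat.one_le_of_lt hN)
  simp only [Nat.cast_one, Real.one_rpow, mul_one] at h1
  rw [h0, hscale]
  have := mul_le_mul_of_nonneg_left h1 hM₀
  linarith

/-- THE TAILS OF THE POWER PROFILE FROM ABOVE, EVERY `q ≥ 1`: for `ρ(a) = M₀∕((a+1)^q(a+1))` (`M₀ ≥ 0`) and `k ≤ N`,
`Σ_{a<N} ρ(a) − Σ_{a<k} ρ(a) ≤ M₀(1 + 2^q∕q)∕(k+1)^q` (`k = 0`: `powerProfileAll_sum_le` and `1 ≤ 2^q`; `k ≥ 1`: the `(1+q)`-tail `≤ M₀∕(q k^q)` and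
`(k+1)^q ≤ (2k)^q = 2^q k^q`). [folklore] -/
theorem powerProfileAll_tail_le {M₀ q : ℝ} (hM₀ : 0 ≤ M₀) (hq1 : 1 ≤ q)
    (hρ : ∀ a, ρ a = M₀ / ((((a : ℝ) + 1) ^ q) * ((a : ℝ) + 1))) {k N : ℕ} (hkN : k ≤ N) :
    ∑ a ∈ range N, ρ a - ∑ a ∈ range k, ρ a ≤ M₀ * (1 + 2 ^ q / q) / ((k : ℝ) + 1) ^ q := by
  have hq0 : 0 < q := by linarith
  have hρ0 : ∀ a, 0 ≤ ρ a := fun a => by rw [hρ a]; positivity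
  have h2q1 : (1 : ℝ) ≤ 2 ^ q := Real.one_le_rpow (by norm_num) hq0.le
  have h2q0 : (0 : ℝ) < 2 ^ q := by linarith
  have hk1 : (0 : ℝ) < (k : ℝ) + 1 := by positivity
  have hk1q : 0 < ((k : ℝ) + 1) ^ q := Real.rpow_pos_of_pos hk1 q
  rcases Nat.eq_zero_or_pos k with hk | hk
  · -- `k = 0`
    subst hk
    simp only [Finset.sum_range_zero, sub_zero, Nat.cast_zero, zero_add, Real.one_rpow, div_one]
    refine (powerProfileAll_sum_le hM₀ hq1 hρ N).trans (mul_le_mul_of_nonneg_left ?_ hM₀)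
    have : 1 / q ≤ 2 ^ q / q := div_le_div_of_nonneg_right h2q1 hq0.le
    linarith
  · -- `k ≥ 1`
    rw [← Finset.sum_Ico_eq_sub _ hkN]
    have hk0 : (0 : ℝ) < k := by exact_mod_cast hk
    have hkq : 0 < (k : ℝ) ^ q := Real.rpow_pos_of_pos hk0 q
    have hscale : ∑ a ∈ Ico k N, ρ a = M₀ * ∑ a ∈ Ico k N, 1 / ((((a : ℝ) + 1) ^ q) * ((a : ℝ) + 1)) := by
      rw [Finset.mul_sum]; exact sum_congr rfl fun a _ => by rw [hρ a]; ring
    have h1 := sum_Ico_tail_le hq1 hk hkN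
    have hkk : ((k : ℝ) + 1) ^ q ≤ 2 ^ q * (k : ℝ) ^ q := by
      have hk1' : (1 : ℝ) ≤ k := by exact_mod_cast hk
      calc ((k : ℝ) + 1) ^ q ≤ (2 * (k : ℝ)) ^ q := Real.rpow_le_rpow hk1.le (by linarith) hq0.le
        _ = 2 ^ q * (k : ℝ) ^ q := Real.mul_rpow (by norm_num) hk0.le
    have h2 : 1 / (q * (k : ℝ) ^ q) ≤ (2 ^ q / q) / ((k : ℝ) + 1) ^ q := by
      rw [div_div, div_le_div_iff₀ (by positivity) (by positivity)]
      nlinarith [hq0]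
    rw [hscale]
    calc M₀ * ∑ a ∈ Ico k N, 1 / ((((a : ℝ) + 1) ^ q) * ((a : ℝ) + 1)) ≤ M₀ * ((2 ^ q / q) / ((k : ℝ) + 1) ^ q) :=
          mul_le_mul_of_nonneg_left (h1.trans h2) hM₀
      _ ≤ M₀ * (1 + 2 ^ q / q) / ((k : ℝ) + 1) ^ q := by
          rw [mul_div_assoc]
          exact mul_le_mul_of_nonneg_left (div_le_div_of_nonneg_right (by linarith) hk1q.le) hM₀

/-- THE TAILS OF THE POWER PROFILE FROM BELOW, EVERY `q ≥ 0`: `k ≥ 1`, `N ≥ 2k` ⇒ `(M₀∕(2·2^q))∕(k+1)^q ≤ Σ_{a<N} ρ(a) − Σ_{a<k} ρ(a)` (the block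
`a ∈ [k, 2k)` has `k` terms each `≥ M₀∕((2k)^q·2k)`, and `(2k)^q ≤ 2^q(k+1)^q`). [folklore] -/
theorem powerProfileAll_tail_ge {M₀ q : ℝ} (hM₀ : 0 ≤ M₀) (hq0 : 0 ≤ q)
    (hρ : ∀ a, ρ a = M₀ / ((((a : ℝ) + 1) ^ q) * ((a : ℝ) + 1))) {k N : ℕ} (hk : 1 ≤ k) (hkN : 2 * k ≤ N) :
    M₀ / (2 * 2 ^ q) / ((k : ℝ) + 1) ^ q ≤ ∑ a ∈ range N, ρ a - ∑ a ∈ range k, ρ a := by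
  have hρ0 : ∀ a, 0 ≤ ρ a := fun a => by rw [hρ a]; positivity
  rw [← Finset.sum_Ico_eq_sub _ (by omega : k ≤ N)]
  have hk0 : (0 : ℝ) < k := by exact_mod_cast hk
  have h2k : (0 : ℝ) < 2 * (k : ℝ) := by positivity
  have h2kq : 0 < (2 * (k : ℝ)) ^ q := Real.rpow_pos_of_pos h2k q
  have hk1q : 0 < ((k : ℝ) + 1) ^ q := Real.rpow_pos_of_pos (by positivity) q
  have h2q0 : (0 : ℝ) < 2 ^ q := Real.rpow_pos_of_pos (by norm_num) q
  have hblock : ∑ a ∈ Ico k (2 * k), ρ a ≤ ∑ a ∈ Ico k N, ρ a :=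
    Finset.sum_le_sum_of_subset_of_nonneg (Finset.Ico_subset_Ico_right hkN) fun a _ _ => hρ0 a
  have hterm : ∀ a ∈ Ico k (2 * k), M₀ / ((2 * (k : ℝ)) ^ q * (2 * (k : ℝ))) ≤ ρ a := by
    intro a ha
    have ha' := (Finset.mem_Ico.mp ha).2
    have ha1 : (a : ℝ) + 1 ≤ 2 * k := by exact_mod_cast (by omega : a + 1 ≤ 2 * k)
    have ha0 : (0 : ℝ) < (a : ℝ) + 1 := by positivity
    rw [hρ a]
    refine div_le_div_of_nonneg_left hM₀ (by positivity) ?_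
    exact mul_le_mul (Real.rpow_le_rpow ha0.le ha1 hq0) ha1 ha0.le h2kq.le
  have hsum := Finset.card_nsmul_le_sum (Ico k (2 * k)) ρ _ hterm
  rw [Nat.card_Ico, show 2 * k - k = k by omega, nsmul_eq_mul] at hsum
  refine le_trans ?_ (hsum.trans hblock)
  have e : (k : ℝ) * (M₀ / ((2 * (k : ℝ)) ^ q * (2 * (k : ℝ)))) = M₀ / 2 / (2 * (k : ℝ)) ^ q := by
    field_simp
  rw [e]
  have h2kle : (2 * (k : ℝ)) ^ q ≤ 2 ^ q * ((k : ℝ) + 1) ^ q := by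
    calc (2 * (k : ℝ)) ^ q ≤ (2 * ((k : ℝ) + 1)) ^ q := Real.rpow_le_rpow h2k.le (by linarith) hq0
      _ = 2 ^ q * ((k : ℝ) + 1) ^ q := Real.mul_rpow (by norm_num) (by positivity)
  rw [div_div, div_le_div_iff₀ (by positivity) h2kq]
  nlinarith [hM₀, h2kle, hk1q.le]

/-! ## §2 The rate for every power profile `q > 1` -/

/-- **ROAD P3 — THE RATE IN THE CUTOFF FOR THE POWER PROFILE `ρ(a) = M₀∕(a+1)^{1+q}`, EVERY `q > 1`, UPPER SIDE, ALL CUTOFFS** (box-type smallness).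
A pinned family of runs of the order-0 profile family with `ρ(a) = M₀∕((a+1)^q(a+1))` (`M₀ > 0`, `q > 1`), in ]0,γ], `Σ_{a<N} ρ_a ≤ W`, `2Wγ < b`; with
`T₀ = M₀(1 + 2^q∕q)`, `C_w = (1−Wγ∕b)∕(1−2Wγ∕b)`: for every `m` with `C_w·T₀·2^q(2 + 1∕(q−1)) ≤ b√b·√m` and EVERY cutoff `n`,
`0 ≤ astar g m − invSq g m n ≤ (4C_w∕√b)·√m·T₀∕(n+2)^q`. [cite: Balaban1987RG1, (0.20) p.256, (0.31) and Thm 2 p.259] -/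
theorem powerProfileAll_rate {M₀ q : ℝ}
    (hβ : ∀ (k : ℕ) (p : Fin (k + 1) → ℝ),
      β k p = b + ∑ i : Fin (k + 1), ρ (k - i) * min (p (Fin.last k)) (|p (Fin.last k) - p i|))
    (hb : 0 < b) (hγ : 0 < γ) (hM₀ : 0 < M₀) (hq1 : 1 < q)
    (hρ : ∀ a, ρ a = M₀ / ((((a : ℝ) + 1) ^ q) * ((a : ℝ) + 1)))
    (hρW : ∀ n, ∑ a ∈ range n, ρ a ≤ W) (hsmall2 : 2 * W * γ < b)
    {g : ℕ → ℕ → ℝ} {gIR : ℝ} (hrun : ∀ K, RGEqH K β (g K)) (hbox : ∀ K i, i ≤ K → 0 < g K i ∧ g K i ≤ γ)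
    (hpin : ∀ K, g K K = gIR) {m : ℕ}
    (hm : (1 - W * γ / b) / (1 - 2 * W * γ / b) * (M₀ * (1 + 2 ^ q / q) * (2 ^ q * (2 + 1 / (q - 1))))
      ≤ b * Real.sqrt b * Real.sqrt (m : ℝ)) (n : ℕ) :
    0 ≤ astar g m - invSq g m n ∧ astar g m - invSq g m n
      ≤ 4 * ((1 - W * γ / b) / (1 - 2 * W * γ / b)) / Real.sqrt b * Real.sqrt (m : ℝ)
        * (M₀ * (1 + 2 ^ q / q) / ((((n + 1 : ℕ) : ℝ)) + 1) ^ q) := by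
  have hq0 : 0 < q := by linarith
  have hρ0 : ∀ a, 0 ≤ ρ a := fun a => by rw [hρ a]; positivity
  have hT₀ : 0 ≤ M₀ * (1 + 2 ^ q / q) := by positivity
  exact powerTailAll_rate hβ hb hγ hρ0 hρW hsmall2 hq1 hT₀ (fun k N hkN => powerProfileAll_tail_le hM₀.le hq1.le hρ hkN) hrun hbox hpin hm n

/-- **THE SAME PROFILE, UPPER SIDE UNDER `Wγ < b`, ALL CUTOFFS**: `T₀ = M₀(1 + 2^q∕q)`; thresholds `2T₀·2^q(2+1∕(q−1)) ≤ b√b·√m` and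
`2√2·T₀∕(q−1) ≤ (1−Wγ∕b)·b√b·m√m` ⇒ for EVERY `n`: `0 ≤ astar g m − invSq g m n ≤ (8∕√b)·√m·T₀∕(n+2)^q`.
[cite: Balaban1987RG1, (0.20) p.256, (0.31) and Thm 2 p.259] -/
theorem powerProfileAll_rate_tail {M₀ q : ℝ}
    (hβ : ∀ (k : ℕ) (p : Fin (k + 1) → ℝ),
      β k p = b + ∑ i : Fin (k + 1), ρ (k - i) * min (p (Fin.last k)) (|p (Fin.last k) - p i|))
    (hb : 0 < b) (hγ : 0 < γ) (hM₀ : 0 < M₀) (hq1 : 1 < q)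
    (hρ : ∀ a, ρ a = M₀ / ((((a : ℝ) + 1) ^ q) * ((a : ℝ) + 1)))
    (hρW : ∀ n, ∑ a ∈ range n, ρ a ≤ W) (hsmall : W * γ < b)
    {g : ℕ → ℕ → ℝ} {gIR : ℝ} (hrun : ∀ K, RGEqH K β (g K)) (hbox : ∀ K i, i ≤ K → 0 < g K i ∧ g K i ≤ γ)
    (hpin : ∀ K, g K K = gIR) {m : ℕ}
    (hm : 2 * (M₀ * (1 + 2 ^ q / q) * (2 ^ q * (2 + 1 / (q - 1)))) ≤ b * Real.sqrt b * Real.sqrt (m : ℝ))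
    (hmthr : 2 * Real.sqrt 2 * (M₀ * (1 + 2 ^ q / q) / (q - 1)) ≤ (1 - W * γ / b) * (b * Real.sqrt b) * ((m : ℝ) * Real.sqrt (m : ℝ)))
    (n : ℕ) :
    0 ≤ astar g m - invSq g m n ∧ astar g m - invSq g m n
      ≤ 8 / Real.sqrt b * Real.sqrt (m : ℝ) * (M₀ * (1 + 2 ^ q / q) / ((((n + 1 : ℕ) : ℝ)) + 1) ^ q) := by
  have hq0 : 0 < q := by linarith
  have hρ0 : ∀ a, 0 ≤ ρ a := fun a => by rw [hρ a]; positivity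
  have hT₀ : 0 ≤ M₀ * (1 + 2 ^ q / q) := by positivity
  exact powerTailAll_rate_tail hβ hb hγ hρ0 hρW hsmall hq1 hT₀ (fun k N hkN => powerProfileAll_tail_le hM₀.le hq1.le hρ hkN)
    hrun hbox hpin hm hmthr n

/-- **THE SAME PROFILE, LOWER SIDE, POINTWISE** (every `q ≥ 0`, `Wγ < b`): for `1 ≤ m ≤ n+1`,
`√m·(M₀∕(2·2^q))∕(n+m+1)^q ≤ 8κ₂√b₂(1+Wγ∕b)·(astar g m − invSq g m n)∕(1 − Wγ∕b)`
(generation 50's `…RateUniform.powerTail_rate_lower_pointwise` with the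
minorant `T₁ = M₀∕(2·2^q)` of `powerProfileAll_tail_ge`). [cite: Balaban1987RG1, (0.20) p.256, (0.31) and Thm 2 p.259] -/
theorem powerProfileAll_rate_lower_pointwise {M₀ q : ℝ}
    (hβ : ∀ (k : ℕ) (p : Fin (k + 1) → ℝ),
      β k p = b + ∑ i : Fin (k + 1), ρ (k - i) * min (p (Fin.last k)) (|p (Fin.last k) - p i|))
    (hb : 0 < b) (hγ : 0 < γ) (hM₀ : 0 < M₀) (hq0 : 0 ≤ q)
    (hρ : ∀ a, ρ a = M₀ / ((((a : ℝ) + 1) ^ q) * ((a : ℝ) + 1)))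
    (hρW : ∀ n, ∑ a ∈ range n, ρ a ≤ W) (hsmall : W * γ < b)
    {g : ℕ → ℕ → ℝ} {gIR : ℝ} (hrun : ∀ K, RGEqH K β (g K)) (hbox : ∀ K i, i ≤ K → 0 < g K i ∧ g K i ≤ γ)
    (hpin : ∀ K, g K K = gIR) {m n : ℕ} (hm : 1 ≤ m) (hmn : m ≤ n + 1) :
    Real.sqrt (m : ℝ) * (M₀ / (2 * 2 ^ q) / ((((n + m : ℕ) : ℝ)) + 1) ^ q)
      ≤ 8 * ((1 / gIR ^ 2 + (b + W * γ)) / b) * Real.sqrt (1 / gIR ^ 2 + (b + W * γ)) * (1 + W * γ / b)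
          * ((astar g m - invSq g m n) / (1 - W * γ / b)) := by
  have hρ0 : ∀ a, 0 ≤ ρ a := fun a => by rw [hρ a]; positivity
  have h2q0 : (0 : ℝ) < 2 ^ q := Real.rpow_pos_of_pos (by norm_num) q
  exact powerTail_rate_lower_pointwise hβ hb hγ hρ0 hρW hsmall hq0 (by positivity : 0 ≤ M₀ / (2 * 2 ^ q))
    (fun k N hk hkN => powerProfileAll_tail_ge hM₀.le hq0 hρ hk hkN) hrun hbox hpin hm hmn

/-- **END — A POWER-PROFILE FAMILY OF ANY EXPONENT `q > 1` WITH ITS RATE TWO-SIDED AT EVERY INFRARED DISTANCE.**  For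
`ρ(a) = M₀∕((a+1)^q(a+1))` with `M₀ > 0`, `q > 1` (finite moments of every order `< q`), and `b > 0`, `γ > 0` with `2M₀(1+1∕q)γ ≤ b`, `g_IR ∈ ]0,γ]`
(`W = M₀(1+1∕q)`, so `Wγ ≤ b∕2 < b`): there is a pinned family of runs of the order-0 profile family such that AT EVERY infrared distance `m`
above the two thresholds (`2T₀·2^q(2+1∕(q−1)) ≤ b√b√m`, `2√2·T₀∕(q−1) ≤ (1−Wγ∕b)b√b·m√m`, `T₀ = M₀(1+2^q∕q)`) and every cutoff `n` with `1 ≤ m ≤ n+1`,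
BOTH `astar g m − invSq g m n ≤ (8∕√b)·√m·T₀∕(n+2)^q` AND `√m·(M₀∕(2·2^q))∕(n+m+1)^q ≤ 8κ₂√b₂(1+Wγ∕b)·(astar g m − invSq g m n)∕(1 − Wγ∕b)` — the
census line for `p = 1 + q ≥ 3`. [cite: Balaban1987RG1, (0.20) p.256, (0.31) and Thm 2 p.259] -/
theorem exists_family_powerProfileAll_rate {M₀ q b γ gIR : ℝ} (hM₀ : 0 < M₀) (hq1 : 1 < q)
    (hρ : ∀ a, ρ a = M₀ / ((((a : ℝ) + 1) ^ q) * ((a : ℝ) + 1)))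
    (hb : 0 < b) (hγ : 0 < γ) (hsmall : 2 * (M₀ * (1 + 1 / q)) * γ ≤ b) (hgIR : 0 < gIR) (hgIRγ : gIR ≤ γ) :
    ∃ (β : HBeta) (g : ℕ → ℕ → ℝ),
      (∀ (k : ℕ) (p : Fin (k + 1) → ℝ),
          β k p = b + ∑ i : Fin (k + 1), ρ (k - i) * min (p (Fin.last k)) (|p (Fin.last k) - p i|))
      ∧ (∀ K, RGEqH K β (g K)) ∧ (∀ K i, i ≤ K → 0 < g K i ∧ g K i ≤ γ) ∧ (∀ K, g K K = gIR)
      ∧ (∀ m n : ℕ, 2 * (M₀ * (1 + 2 ^ q / q) * (2 ^ q * (2 + 1 / (q - 1)))) ≤ b * Real.sqrt b * Real.sqrt (m : ℝ) →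
          2 * Real.sqrt 2 * (M₀ * (1 + 2 ^ q / q) / (q - 1))
            ≤ (1 - M₀ * (1 + 1 / q) * γ / b) * (b * Real.sqrt b) * ((m : ℝ) * Real.sqrt (m : ℝ)) → 1 ≤ m → m ≤ n + 1 →
          astar g m - invSq g m n ≤ 8 / Real.sqrt b * Real.sqrt (m : ℝ) * (M₀ * (1 + 2 ^ q / q) / ((((n + 1 : ℕ) : ℝ)) + 1) ^ q)
          ∧ Real.sqrt (m : ℝ) * (M₀ / (2 * 2 ^ q) / ((((n + m : ℕ) : ℝ)) + 1) ^ q)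
            ≤ 8 * ((1 / gIR ^ 2 + (b + M₀ * (1 + 1 / q) * γ)) / b) * Real.sqrt (1 / gIR ^ 2 + (b + M₀ * (1 + 1 / q) * γ))
              * (1 + M₀ * (1 + 1 / q) * γ / b)
              * ((astar g m - invSq g m n) / (1 - M₀ * (1 + 1 / q) * γ / b))) := by
  let β : HBeta := fun k p => b + ∑ i : Fin (k + 1), ρ (k - i) * min (p (Fin.last k)) (|p (Fin.last k) - p i|)
  have hβ : ∀ (k : ℕ) (p : Fin (k + 1) → ℝ),
      β k p = b + ∑ i : Fin (k + 1), ρ (k - i) * min (p (Fin.last k)) (|p (Fin.last k) - p i|) := fun k p => rfl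
  have hq0 : 0 < q := by linarith
  have hρ0 : ∀ a, 0 ≤ ρ a := fun a => by rw [hρ a]; positivity
  have hρW := powerProfileAll_sum_le hM₀.le hq1.le hρ
  have hW0 : 0 < M₀ * (1 + 1 / q) := by positivity
  have hsmall' : (M₀ * (1 + 1 / q)) * γ < b := by nlinarith [mul_pos hW0 hγ]
  obtain ⟨g, hrun, hbox, hpin⟩ :=
    RemainderExplicitHistoryDiagonalProfile.runFamily_exists (W := M₀ * (1 + 1 / q)) hβ hb hγ hρ0 hρW hsmall hgIR hgIRγ
  refine ⟨β, g, hβ, hrun, hbox, hpin, fun m n hm hmthr hm1 hmn => ⟨?_, ?_⟩⟩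
  · exact (powerProfileAll_rate_tail hβ hb hγ hM₀ hq1 hρ hρW hsmall' hrun hbox hpin hm hmthr n).2
  · exact powerProfileAll_rate_lower_pointwise hβ hb hγ hM₀ hq0.le hρ hρW hsmall' hrun hbox hpin hm1 hmn

end Summit.QuantumFields.BalabanUV.Beta.RemainderExplicitHistoryDiagonalRatePowerProfileAll

end
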